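import Literature.NumberTheory.GaloisCohomology.BrauerSumTwoTorsionAtOnePlace
import Literature.NumberTheory.GaloisRepresentations.ContinuousShapiroLiftRestrictHom
import Literature.NumberTheory.GaloisRepresentations.ContinuousCorestriction
import Literature.NumberTheory.EllipticCurves.CyclotomicLayerPairingOfFun
import HarnessLib

/-!
# Sketch (stub-ideation k2·g10) — the INTERIOR of `stub_reciprocity` (EH, STUB-PLAN rev 11 item 5 / Q46 (b)):
# Tate reciprocity along the layers `ℚ_n` in the Shapiro model, TRANSFERRED from the TP2 (PT-orth) chain to the
# `ρ`-coefficient, `S₀`-IMPRIMITIVE setting of RSL_g — typed dictionary + the two bricks TP2 did not need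

Crux `ResidualThetaCountLowerPureAtTwo` (stmt-BirchSwinnertonDyer-26074), stub `stub_cmLambdaLower` = RSL_g BY NAME
(stmt-BirchSwinnertonDyer-22608), skeleton `Lines/bt26_lambda.lean` v6 (sha16 6a72b11b74fc35ef) — the stub is NOT re-typed here.
This file is vocabulary + small PROVED glue for the idea card `Ideas/stub-cmlambdalower-k2-g10.md`; RSL_g / 26074 / BSD are NOT
proved by any of this.  No `sorry`.

* §1 (H1, PROVED) `two_nsmul_sum_localInvariantMap_eq_zero_of_forall_not_mem[_levels|_of_localization_eq_zero]` — the
  FINITE-SET receptacle of Tate's reciprocity law with the real place `2`-torsion: if the local invariants of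
  `c ∈ H²(Γ_K, μₙ)` vanish at the finite `v ∉ S₁` then `2 • Σ_{v ∈ S₁} inv_v(loc_v c) = 0` (the tree has only the ONE-place form
  `two_nsmul_localInvariantMap_eq_zero_of_forall_ne`, which sufficed for TP2 because `Sel(E/ℚ_n)` is `p`-PRIMITIVE: every
  local term off `p` vanishes; RSL_g's `Sg` is `S₀`-imprimitive, so the terms at `S₀` survive and must be COLLECTED, not killed).
* §2 (H3, PROVED) `castHom_eq_zero_of_two_nsmul_eq_zero`, `eq_zero_of_compatible_of_two_nsmul_eq_zero` — the honest factor `2`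
  of §1 DIES in the `2`-adic limit: a `k`-compatible system `a_k ∈ ℤ/2^k` with `2 • a_k = 0` for all `k` is identically `0`
  (so EH holds EXACTLY for the pinned `ℤ₂`/`ℚ₂/ℤ₂`-valued pairings; no slack `a := 2`, no appeal to k2-g9's regularity at `∞`).
* §3 (H2, SIGNATURE `MackeyOrbitCupFormula`, the NEW M-sized helper) — Mackey's double-coset formula for CUP PRODUCTS of Shapiro
  lifts restricted along `θ : D → G`, ALL orbits, `N` normal: `θ^*(Sh a ∪_{ΣP} Sh b) = Σ_i Sh^D(θ_N^*(g_i·a)) ∪_{ΣP|θ} Sh^D(θ_N^*(g_i·b))`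
  — the tree has the ONE-orbit case (`map_cupProduct_coindFin_shapiroLift`, used by TP2 at `v ∣ p`) and the orbitwise VANISHING
  case (`map_shapiroLift_eq_zero_of_reps`), and the `H¹`-corestriction analogue with all double cosets
  (`resSubgroup_cores_eq_sum_cores_conjRes`); the quantitative cup formula is what the `S₀`-terms of EH need
  (`#orbits of Γ_ℓ on Γ_ℚ/Γ_n = #places of ℚ_n over ℓ = min(2^n, 2^{n_ℓ})`, the (C5) coset count).
* §4 (PROVED assembly) `two_nsmul_sum_orbit_layerPairingH1Of_eq_zero` — levelwise EH in the lead's (C3)/(C5) currency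
  (`CyclotomicLayer.layerPairingH1Of … κ v n (layerLocOf (g·a)) (layerLocOf (g·b))`, `p = 2`): GIVEN the per-place Mackey
  evaluations (output of §3 at `v ∈ S₁ = {2} ∪ S₀`) and the vanishing of the localisations off `S₁`, the double sum over places and
  orbits is `2`-torsion — §1 applied to the global Shapiro cup class.

References: [CasselsFrohlichANT1967] Ch. VII §11 (Tate); [MilneADT2006] I Thm. 4.10 (b), I Thm. 2.6; [NeukirchSchmidtWingberg2008]
I §5 (1.5.6)–(1.5.7), I §6 (1.6.4)–(1.6.5), (8.1.?) ; [Brown1982] III (5.6)(b), (9.5); [Kobayashi2003] (7.16)–(7.21); [Kato2004Asterisque]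
§17.13; [PerrinRiou1994Invent] §3.6.1; [Rubin2000EulerSystems] Thm. 1.7.3.
-/

set_option autoImplicit false
-- the Cruxes namespace of this sub repeats the summit name by design (D-0017 nested layout)
set_option linter.dupNamespace false

noncomputable section

open scoped Classical

namespace Summit.BirchSwinnertonDyer.BirchSwinnertonDyer.Cruxes.ResidualThetaCountLowerPureAtTwo.SideaK2G10

open CategoryTheory Function Field NumberField IsDedekindDomain
open scoped NumberField
open _root_.ContinuousCohomology
open Literature.NumberTheory.GaloisRepresentations
open Literature.NumberTheory.GaloisRepresentations.DiscreteGaloisModule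
open Literature.NumberTheory.GaloisCohomology

/-! ## §1 H1 — the finite-set receptacle of Tate reciprocity, real places `2`-torsion (PROVED) -/

section Receptacle

variable (K : Type) [Field K] [NumberField K] (n : ℕ) [NeZero n]

/-- **H1.** If the invariants of `c ∈ H²(Γ_K, μₙ)` vanish at every finite `v ∉ S₁`, then `2 • Σ_{v ∈ S₁} inv_v(loc_v c) = 0`
(Tate reciprocity `Σ_all inv = 0` for THE canonical invariant maps; each real place contributes a `2`-torsion invariant).
[cite: CasselsFrohlichANT1967, Ch. VII §11] [cite: MilneADT2006, Ch. I, Thm. 4.10(b)] -/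
theorem two_nsmul_sum_localInvariantMap_eq_zero_of_forall_not_mem (S₁ : Finset (HeightOneSpectrum (𝓞 K)))
    (c : galoisCohomology (mu K n) 2)
    (h : ∀ v : HeightOneSpectrum (𝓞 K), v ∉ S₁ →
      localInvariantMap K n v (galoisCohomology.localization (mu K n) (Sum.inr v) 2 c) = 0) :
    2 • ∑ v ∈ S₁, localInvariantMap K n v (galoisCohomology.localization (mu K n) (Sum.inr v) 2 c) = 0 := by
  classical
  -- the finite set `S = S₁ ∪ {infinite places}`
  let S : Finset (Place K) := S₁.image Sum.inr ∪ Finset.univ.image Sum.inl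
  have hS : ∀ v ∉ S, LocalInvariants.canonical K n v (galoisCohomology.localization (mu K n) v 2 c) = 0 := by
    rintro (w | v) hv
    · exact absurd (Finset.mem_union_right _ (Finset.mem_image_of_mem _ (Finset.mem_univ w))) hv
    · have hv' : v ∉ S₁ := fun hm ↦ hv (Finset.mem_union_left _ (Finset.mem_image_of_mem _ hm))
      rw [LocalInvariants.canonical_inr]
      exact h v hv'
  have hsum := sumInvLocalizationEqZero_canonical_of_numberField K n c S hS
  have hdisj : Disjoint (S₁.image Sum.inr) (Finset.univ.image Sum.inl : Finset (Place K)) := by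
    refine Finset.disjoint_left.mpr fun x hx hx' ↦ ?_
    obtain ⟨v, -, rfl⟩ := Finset.mem_image.mp hx
    obtain ⟨w, -, hw⟩ := Finset.mem_image.mp hx'
    exact Sum.inl_ne_inr hw
  rw [Finset.sum_union hdisj, Finset.sum_image fun _ _ _ _ e ↦ Sum.inr_injective e,
    Finset.sum_image fun _ _ _ _ e ↦ Sum.inl_injective e] at hsum
  simp only [LocalInvariants.canonical_inr] at hsum
  -- `Σ_{S₁} inv_v = −Σ_w inv_w`, and `2 • inv_w = 0`
  have e : ∑ v ∈ S₁, localInvariantMap K n v (galoisCohomology.localization (mu K n) (Sum.inr v) 2 c) =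
      -∑ w : InfinitePlace K, LocalInvariants.canonical K n (Sum.inl w)
        (galoisCohomology.localization (mu K n) (Sum.inl w) 2 c) := eq_neg_of_add_eq_zero_left hsum
  rw [e, smul_neg, Finset.smul_sum, neg_eq_zero]
  refine Finset.sum_eq_zero fun w _ ↦ ?_
  rw [LocalInvariants.canonical_inl]
  exact two_nsmul_archimedeanInvariantMap _

/-- **H1, classes form.** If the localisations of `c` VANISH (as classes) at the finite `v ∉ S₁`, then
`2 • Σ_{v ∈ S₁} inv_v(loc_v c) = 0`. [cite: CasselsFrohlichANT1967, Ch. VII §11] [cite: MilneADT2006, Ch. I, Thm. 4.10(b)] -/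
theorem two_nsmul_sum_localInvariantMap_eq_zero_of_localization_eq_zero (S₁ : Finset (HeightOneSpectrum (𝓞 K)))
    (c : galoisCohomology (mu K n) 2)
    (h : ∀ v : HeightOneSpectrum (𝓞 K), v ∉ S₁ → galoisCohomology.localization (mu K n) (Sum.inr v) 2 c = 0) :
    2 • ∑ v ∈ S₁, localInvariantMap K n v (galoisCohomology.localization (mu K n) (Sum.inr v) 2 c) = 0 :=
  two_nsmul_sum_localInvariantMap_eq_zero_of_forall_not_mem K n S₁ c fun v hv ↦ by rw [h v hv, map_zero]

/-- **H1, levels chosen place by place** (the shape used along a `ℤ_p`-tower: the term at `v ∉ S₁` is killed at a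
`v`-dependent coefficient level `μₙ ↪ μ_N`). [cite: CasselsFrohlichANT1967, Ch. VII §11] [cite: SerreLocalFields1979, XIII §3 Cor. 3] -/
theorem two_nsmul_sum_localInvariantMap_eq_zero_of_forall_not_mem_levels (S₁ : Finset (HeightOneSpectrum (𝓞 K)))
    (c : galoisCohomology (mu K n) 2)
    (h : ∀ v : HeightOneSpectrum (𝓞 K), v ∉ S₁ → ∃ (N : ℕ) (_ : NeZero N) (hdvd : n ∣ N),
      haveI : CompactSpace (absoluteGaloisGroup K) := absoluteGaloisGroup_compactSpace K
      galoisCohomology.localization (mu K N) (Sum.inr v) 2 (cohomologyMap (muInclHom K hdvd) 2 c) = 0) :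
    2 • ∑ v ∈ S₁, localInvariantMap K n v (galoisCohomology.localization (mu K n) (Sum.inr v) 2 c) = 0 := by
  refine two_nsmul_sum_localInvariantMap_eq_zero_of_forall_not_mem K n S₁ c fun v hv ↦ ?_
  obtain ⟨N, _, hdvd, hN⟩ := h v hv
  rw [(localization_muInclHom_eq_zero_iff hdvd v c).mp hN, map_zero]

end Receptacle

/-! ## §2 H3 — the factor `2` dies in the `2`-adic limit (PROVED) -/

section Limit

/-- If `2 • b = 0` in `ℤ/2^{k+1}` then `b ≡ 0 (mod 2^k)`. [folklore] -/
theorem castHom_eq_zero_of_two_nsmul_eq_zero (k : ℕ) (b : ZMod (2 ^ (k + 1))) (hb : 2 • b = 0) :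
    ZMod.castHom (pow_dvd_pow 2 (Nat.le_succ k)) (ZMod (2 ^ k)) b = 0 := by
  have h2 : ((2 * b.val : ℕ) : ZMod (2 ^ (k + 1))) = 0 := by
    rw [Nat.cast_mul, Nat.cast_ofNat, ZMod.natCast_zmod_val, two_mul, ← two_nsmul]
    exact hb
  rw [CharP.cast_eq_zero_iff (ZMod (2 ^ (k + 1))) (2 ^ (k + 1))] at h2
  have h22 : 2 * 2 ^ k ∣ 2 ^ (k + 1) := dvd_of_eq (pow_succ' 2 k).symm
  have hk : 2 ^ k ∣ b.val := Nat.dvd_of_mul_dvd_mul_left two_pos (h22.trans h2)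
  rw [ZMod.castHom_apply, ZMod.cast_eq_val, CharP.cast_eq_zero_iff (ZMod (2 ^ k)) (2 ^ k)]
  exact hk

/-- **H3.** A `k`-compatible system `a_k ∈ ℤ/2^k` (`a_{k+1} ↦ a_k`) with `2 • a_k = 0` for every `k` vanishes identically:
the honest factor `2` of the levelwise reciprocity (§1) disappears in the limit defining the pinned `ℤ₂`-adic pairings
(K-b / (ADJ) compatibility supplies `hcompat`). [folklore] -/
theorem eq_zero_of_compatible_of_two_nsmul_eq_zero (a : ∀ k : ℕ, ZMod (2 ^ k))
    (hcompat : ∀ k, ZMod.castHom (pow_dvd_pow 2 (Nat.le_succ k)) (ZMod (2 ^ k)) (a (k + 1)) = a k)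
    (h2 : ∀ k, 2 • a k = 0) (k : ℕ) : a k = 0 := by
  rw [← hcompat k]
  exact castHom_eq_zero_of_two_nsmul_eq_zero k (a (k + 1)) (h2 (k + 1))

end Limit

/-! ## §3 H2 — Mackey's formula for cup products of Shapiro lifts along `θ`, ALL orbits (SIGNATURE of the new helper) -/

section Mackey

universe u v

variable {R : Type u} [CommRing R] [TopologicalSpace R]
variable {G : Type v} [Group G] [TopologicalSpace G] [IsTopologicalGroup G] [LocallyCompactSpace G]
variable {D : Type v} [Group D] [TopologicalSpace D] [IsTopologicalGroup D] [LocallyCompactSpace D]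

/-- **H2 (the NEW helper, M-sized): Mackey's double-coset formula for CUP PRODUCTS of Shapiro lifts under restriction along
`θ : D → G`, all orbits, `N ⊴ G` open normal.**  Let `N_D := θ⁻¹N` (the same for every orbit since `N` is normal), `s` / `sD`
representatives of `G ⧸ N` / `D ⧸ N_D` with `s 1 = 1`, `sD 1 = 1`, and `g : ι → G` ORBIT REPRESENTATIVES: the map
`(i, y') ↦ θ(sD y')·g_i·N` is a bijection `ι × D ⧸ N_D ≃ G ⧸ N` (the `D`-orbits on `G ⧸ N` are the `θ(D)·g_i·N`, each `≅ D ⧸ N_D`).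
Then for `a ∈ H¹(N, X)`, `b ∈ H¹(N, Y)` and every continuous equivariant pairing `P : X × Y → Z`:
`θ^*(Sh_N^G a ∪_{ΣP} Sh_N^G b) = Σ_i Sh_{N_D}^D(θ_N^*(g_i · a)) ∪_{ΣP|_θ} Sh_{N_D}^D(θ_N^*(g_i · b))` in `H²(D, Z|_θ)`, where
`g · a = conjMap X N g 1 a` (`[φ] ↦ [x ↦ g • φ(g⁻¹ x g)]`).  One orbit (`ι = Unit`, `g = 1`) is the tree's
`map_cupProduct_coindFin_shapiroLift`; the proof is the same on COCYCLES for global representatives ADAPTED to all orbits at once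
(`s(θ(sD y')·g_i·N) := θ(sD y')·g_i`: the global Schreier element at `θ(sD y') g_i N` is `g_i⁻¹ θ(σ) g_i` with `σ` the local
Schreier element, so the `i`-th component of `Sh_N^G f ∘ θ` IS `Sh^D(f_i ∘ θ_N)`, `f_i = g_i • f(g_i⁻¹ · g_i)`), the summed
pairing splitting as `Σ_{G/N} = Σ_i Σ_{D/N_D}` by the bijection, and additivity of `twoCocycleClass`.
[cite: NeukirchSchmidtWingberg2008, I §5 (1.5.6)–(1.5.7) and I §6 Prop. (1.6.4)–(1.6.5)] [cite: Brown1982, III §5 (5.6)(b), III (9.5)] -/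
def MackeyOrbitCupFormula {X Y Z : TopRep.{v} R G} (P : ContPairing X Y Z) (N : Subgroup G) [N.Normal] (θ : D →ₜ* G)
    [Fintype (G ⧸ N)] [Fintype (D ⧸ N.comap (θ : D →* G))] (hN : IsOpen (N : Set G)) : Prop :=
  ∀ (ι : Type) [Fintype ι] (g : ι → G)
    (s : G ⧸ N → G) (hs : ∀ y : G ⧸ N, (s y : G ⧸ N) = y) (hs1 : s ((1 : G) : G ⧸ N) = 1)
    (sD : D ⧸ N.comap (θ : D →* G) → D) (hsD : ∀ y, (sD y : D ⧸ N.comap (θ : D →* G)) = y)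
    (hsD1 : sD ((1 : D) : D ⧸ N.comap (θ : D →* G)) = 1),
    Function.Bijective (fun q : ι × (D ⧸ N.comap (θ : D →* G)) => ((θ (sD q.2) * g q.1 : G) : G ⧸ N)) →
    ∀ (a : continuousCohomology 1 (subgroupRep X N)) (b : continuousCohomology 1 (subgroupRep Y N)),
      ContinuousCohomology.map θ (𝟙 (TopRep.res (θ : D →* G) Z)) 2
          ((P.coindFin N).cupProduct (shapiroLift X N hN hs hs1 a) (shapiroLift Y N hN hs hs1 b)) =
        ∑ i : ι, ((P.restrict θ).coindFin (N.comap (θ : D →* G))).cupProduct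
          (shapiroLift (TopRep.res (θ : D →* G) X) (N.comap (θ : D →* G)) (isOpen_comap N θ hN) hsD hsD1
            (ContinuousCohomology.map (comapSubtypeHom N θ) (comapCoeffHom X N θ) 1 (conjMap X N (g i) 1 a)))
          (shapiroLift (TopRep.res (θ : D →* G) Y) (N.comap (θ : D →* G)) (isOpen_comap N θ hN) hsD hsD1
            (ContinuousCohomology.map (comapSubtypeHom N θ) (comapCoeffHom Y N θ) 1 (conjMap Y N (g i) 1 b)))

/-- Sanity: the one-orbit case of `MackeyOrbitCupFormula` (`ι = Unit`, `g = 1`) has the conclusion of the tree's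
`map_cupProduct_coindFin_shapiroLift` up to `conjMap X N 1 1 = id` (`conjMap_one_one`). [cite: NeukirchSchmidtWingberg2008, I §6 Prop. (1.6.4)] -/
example {X : TopRep.{v} R G} (N : Subgroup G) [N.Normal] (a : continuousCohomology 1 (subgroupRep X N)) :
    conjMap X N 1 1 a = a := conjMap_one_one X N a

end Mackey

/-! ## §4 Levelwise EH in the (C3)/(C5) currency, from the per-place Mackey evaluations (PROVED assembly) -/

section Levelwise

open Literature.NumberTheory.EllipticCurves Literature.NumberTheory.EllipticCurves.CyclotomicLayer ZpExtension

attribute [local instance] absoluteGaloisGroup_compactSpace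

variable {M : Type} [AddCommGroup M] [TopologicalSpace M] [DiscreteTopology M] [Finite M]
  (ρM : DiscreteGaloisModule ℚ M) (N : ℕ) [NeZero N]
  (e : M → M → AlgebraicClosure ℚ)
  (hμ : ∀ S T, e S T ^ N = 1)
  (hadd₁ : ∀ S₁ S₂ T, e (S₁ + S₂) T = e S₁ T * e S₂ T)
  (hadd₂ : ∀ S T₁ T₂, e S (T₁ + T₂) = e S T₁ * e S T₂)
  (hgal : ∀ (σ : absoluteGaloisGroup ℚ) (S T : M), σ • e S T = e (ρM σ S) (ρM σ T))
  (κ : ZpExtension ℚ 2) (n : ℕ)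

omit [Finite M] in
/-- **Levelwise EH (one layer `n`, one level `N = 2^k`), assembled.**  For the global Shapiro cup class
`c = Sh_{Γ_n}^{Γ_ℚ} a ∪_{Σe} Sh_{Γ_n}^{Γ_ℚ} b ∈ H²(Γ_ℚ, μ_N)` (ANY class `c` with the two displayed properties will do): if at each
`v ∈ S₁` (`= {2} ∪ S₀`) its invariant is the ORBIT SUM of the layer pairings of the conjugates (`hloc` — the output of H2 §3 +
`layerPairingH1Of_apply`, one orbit at `v ∋ 2` by `quotientPull_layerGroup_bijective`, `min(2^n, 2^{n_ℓ})` orbits at `ℓ ∈ S₀`), and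
its localisation vanishes at the finite `v ∉ S₁` (`hoff` — orbitwise `unramified ∪ unramified = 0`,
`cupProduct_eq_zero_of_mem_unramifiedSubgroup` + `map_shapiroLift_eq_zero_of_reps` on inertia), then the double sum of the pinned
levelwise values is `2`-torsion: `2 • Σ_{v ∈ S₁} Σ_i ⟨loc_n(g_{v,i}·a), loc_n(g_{v,i}·b)⟩_{n,N,v} = 0`.  With §2 along `k` this is
`pair (locd x) s = 0` for the lead's `pair := pair₂ ⊕ Σ_{w,c}` (C5).
[cite: Kobayashi2003, (7.16)–(7.21) (p. 12)] [cite: Kato2004Asterisque, §17.13 (p. 279)] [cite: MilneADT2006, Ch. I, Thm. 4.10(b)] -/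
theorem two_nsmul_sum_orbit_layerPairingH1Of_eq_zero (c : galoisCohomology (mu ℚ N) 2)
    (a b : H1 ρM (κ.layerSubgroup n)) (S₁ : Finset (HeightOneSpectrum (𝓞 ℚ)))
    (ι : HeightOneSpectrum (𝓞 ℚ) → Type) [∀ v, Fintype (ι v)] (g : ∀ v, ι v → absoluteGaloisGroup ℚ)
    (hloc : ∀ v ∈ S₁, localInvariantMap ℚ N v (galoisCohomology.localization (mu ℚ N) (Sum.inr v) 2 c) =
      ∑ i, layerPairingH1Of ρM N e hμ hadd₁ hadd₂ hgal κ v n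
        (layerLocOf ρM κ v n (conjMap ρM.toTopRep (κ.layerSubgroup n) (g v i) 1 a))
        (layerLocOf ρM κ v n (conjMap ρM.toTopRep (κ.layerSubgroup n) (g v i) 1 b)))
    (hoff : ∀ v : HeightOneSpectrum (𝓞 ℚ), v ∉ S₁ → galoisCohomology.localization (mu ℚ N) (Sum.inr v) 2 c = 0) :
    2 • ∑ v ∈ S₁, ∑ i, layerPairingH1Of ρM N e hμ hadd₁ hadd₂ hgal κ v n
        (layerLocOf ρM κ v n (conjMap ρM.toTopRep (κ.layerSubgroup n) (g v i) 1 a))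
        (layerLocOf ρM κ v n (conjMap ρM.toTopRep (κ.layerSubgroup n) (g v i) 1 b)) = 0 := by
  rw [← Finset.sum_congr rfl hloc]
  exact two_nsmul_sum_localInvariantMap_eq_zero_of_localization_eq_zero ℚ N S₁ c hoff

end Levelwise

end Summit.BirchSwinnertonDyer.BirchSwinnertonDyer.Cruxes.ResidualThetaCountLowerPureAtTwo.SideaK2G10

end
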